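import Mathlib
import HarnessLib
import Literature.MathematicalPhysics.KineticTheory.VelocityFlipNoise
import Summits.AtomisticToContinuum.FouriersLaw.Theorems.VanishingNoiseTransferVanishingNoiseBoundFlipDualKuboLink

/-!
# Stub `stub_dualKuboRoadLanded` of line `fekete-usc-one-length` (crux `VanishingNoiseTransfer.VanishingNoiseBound`,
item stmt-AtomisticToContinuum-11976): the dual Kubo road IS landed

Helper file `--supports stmt-AtomisticToContinuum-11976` written by the sister crux `NoisyFourier`
(stmt-AtomisticToContinuum-11977, line `sector-dirichlet-gluing`, stub `stub_flipPositiveConductance`, which rides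
this road): the registered stub `stub_dualKuboRoadLanded` of the skeleton r5 of crux `VanishingNoiseBound` —
"the derivative-free dual forward field hypothesis `FF''(ε)` implies stub S3 `noisyPositiveConductance` verbatim" —
is VERBATIM the landed theorem `VanishingNoiseBound.noisyPositiveConductance_of_dualForwardFields`
(`…VanishingNoiseBoundFlipDualKuboLink`, p105569: energy balance `totalCurrent(μ_δ) = (L−1)γ(T + δ/2 − ⟨p_0²⟩_δ)`,
the dual Kubo identity `μ_δ(p_0² − T)/δ = (γ/2T²)(⟨g_δ, k_0⟩ − ⟨g_δ, k_{L−1}⟩)`, the flip row sum, the Onsager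
sign). This file restates it under the registered name so that the skeleton can import it.

No definitions; axioms `propext`, `Classical.choice`, `Quot.sound` only.
-/

noncomputable section

namespace Summit.AtomisticToContinuum.FouriersLaw.Cruxes.VanishingNoiseBound.FeketeUscOneLength

open MeasureTheory Filter Topology
open Literature.MathematicalPhysics.KineticTheory.HeatConduction

/-- **Registered stub `stub_dualKuboRoadLanded` of line `fekete-usc-one-length`** (crux `VanishingNoiseBound`,
stmt-AtomisticToContinuum-11976): the dual forward field hypothesis `FF''(ε)` — for all admissible parameters,
`T > 0`, `ε > 0`, every flip-steady family unique in its class and every `L ≥ 2`: a `C²` classical equilibrium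
forward field `g 0` of `L_{T,T} + εS` with source `−(p_0² − T)`, `e^{H/4T}`-bounded measurable distributional
forward fields `g δ` of `L_{T+δ/2,T−δ/2} + εS` with source `−(p_0² − T) + μ_δ(p_0² − T)` for `0 < |δ| < δ₀`, and
continuity at `δ = 0` along `δ ≠ 0` of the two Gibbs pairings `⟨g δ, p_b² − T⟩_{μ_T}`, `b = 0, L − 1` — implies
`0 < D_N(ε)` for `N ≥ 2` along every flip-steady family unique in its class. Witness:
`VanishingNoiseBound.noisyPositiveConductance_of_dualForwardFields`. -/
theorem stub_dualKuboRoadLanded : (∀ (ω₂ lam β γ T ε : ℝ), 0 < ω₂ → 0 < lam → 0 < β → 0 < γ → 0 < T → 0 < ε → ∀ μ : (N : ℕ) → ℝ → ℝ → Measure (PhaseSpace N), (∀ (N : ℕ) (T_L T_R : ℝ), 0 < T_L → 0 < T_R → (pinnedChain ω₂ lam β γ).IsFlipSteadyState N T_L T_R ε (μ N T_L T_R) ∧ ∀ ν : Measure (PhaseSpace N), (pinnedChain ω₂ lam β γ).IsFlipSteadyState N T_L T_R ε ν → ν = μ N T_L T_R) → ∀ (L : ℕ) (hL : 2 ≤ L),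 ∃ (g : ℝ → PhaseSpace L → ℝ) (δ₀ : ℝ), 0 < δ₀ ∧ ContDiff ℝ 2 (g 0) ∧ (∀ x, (pinnedChain ω₂ lam β γ).flipGenerator L T T ε (g 0) x = -(Theorems.SuperadditiveResistance.DeviceLiouville.kin L 0 x - T)) ∧ (∀ δ, |δ| < δ₀ → ∃ C : ℝ, ∀ x, |g δ x| ≤ C * Real.exp (1 / (4 * T) * (pinnedChain ω₂ lam β γ).hamiltonian L x)) ∧ (∀ δ, 0 < |δ| → |δ| < δ₀ → Measurable (g δ) ∧ ∀ φ : PhaseSpace L → ℝ, ContDiff ℝ ((⊤ : ℕ∞) : WithTop ℕ∞) φ → HasCompactSupport φ → ∫ x, g δ x * (-((pinnedChain ω₂ lam β γ).generator L (T + δ / 2) (T - δ / 2) φ x) + 2 * γ * ((T + δ / 2) * partialP (⟨0, by omega⟩ : Fin L) (partialP (⟨0, by omega⟩ : Fin L) φ) x + (T - δ / 2) * partialP (⟨L - 1, by omega⟩ : Fin L) (partialP (⟨L - 1, by omega⟩ : Fin L) φ) x) + 2 * γ * φ x + ε * flipNoise L φ x) = ∫ x, (-(Theorems.SuperadditiveResistance.DeviceLiouville.kin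 L 0 x - T) + ∫ y, (Theorems.SuperadditiveResistance.DeviceLiouville.kin L 0 y - T) ∂(μ L (T + δ / 2) (T - δ / 2))) * φ x) ∧ Tendsto (fun δ => ∫ x, g δ x * (Theorems.SuperadditiveResistance.DeviceLiouville.kin L 0 x - T) ∂((pinnedChain ω₂ lam β γ).gibbsMeasure L T)) (𝓝[≠] 0) (𝓝 (∫ x, g 0 x * (Theorems.SuperadditiveResistance.DeviceLiouville.kin L 0 x - T) ∂((pinnedChain ω₂ lam β γ).gibbsMeasure L T))) ∧ Tendsto (fun δ => ∫ x, g δ x * (Theorems.SuperadditiveResistance.DeviceLiouville.kin L (L - 1) x - T) ∂((pinnedChain ω₂ lam β γ).gibbsMeasure L T)) (𝓝[≠] 0) (𝓝 (∫ x, g 0 x * (Theorems.SuperadditiveResistance.DeviceLiouville.kin L (L - 1) x - T) ∂((pinnedChain ω₂ lam β γ).gibbsMeasure L T)))) → ∀ ω₂ lam β γ : ℝ, 0 < ω₂ → 0 < lam → 0 < β → 0 < γ → ∀ T : ℝ, 0 < T → ∀ ε : ℝ, 0 < ε → ∀ μ : (N : ℕ) → ℝ → ℝ → Measure (PhaseSpace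 N), (∀ (N : ℕ) (T_L T_R : ℝ), 0 < T_L → 0 < T_R → (pinnedChain ω₂ lam β γ).IsFlipSteadyState N T_L T_R ε (μ N T_L T_R) ∧ ∀ ν : Measure (PhaseSpace N), (pinnedChain ω₂ lam β γ).IsFlipSteadyState N T_L T_R ε ν → ν = μ N T_L T_R) → ∀ D : ℕ → ℝ, (∀ N : ℕ, Tendsto (fun δ : ℝ => (pinnedChain ω₂ lam β γ).totalCurrent (μ N (T + δ / 2) (T - δ / 2)) / δ) (𝓝[≠] 0) (𝓝 (D N))) → ∀ N : ℕ, 2 ≤ N → 0 < D N :=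
  Summit.AtomisticToContinuum.FouriersLaw.Theorems.VanishingNoiseBound.noisyPositiveConductance_of_dualForwardFields

end Summit.AtomisticToContinuum.FouriersLaw.Cruxes.VanishingNoiseBound.FeketeUscOneLength

end
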